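import Literature.NumberTheory.Sieve.VinogradovExpSumTools
import Mathlib.Analysis.PSeries
import HarnessLib

/-!
# The points `r/N₀` of the discrete circle: arcs, central points, minor points

Topic `Literature/NumberTheory/Sieve`; a PROVED file toward
`Literature.NumberTheory.DiophantineGeometry.XYZUpperHalf` ([Harper2016, Cor. 1], §5, endgame on
`ℤ/N₀`). Elementary bookkeeping for the cubic moment `∑_{r mod N₀} S₁(r/N₀)² S̄₃(r/N₀)`:

* `sum_range_inv_one_add_sq_le_two`: `∑_{j<N} (1+j)^{−2} ≤ 2`;
* `sum_range_inv_one_add_abs_sub_sq_le`: `∑_{r<N} (1+|r − c|)^{−2} ≤ 4` for every real `c ≥ 0`,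
  whence along an arc `∑_r (1 + |(r/N₀ − c')x|)^{−2} ≤ 4` when `x ≥ N₀`
  (`sum_range_inv_one_add_abs_arc_sq_le`);
* `min_le_distInt`: `min(θ, 1−θ) ≤ ‖θ‖`;
* `exists_coprime_approx`: a point `θ ∈ [0,1)` with a rational approximation `|θ − a/q| ≤ Q/x`,
  `1 ≤ q ≤ Q`, `a ∈ ℤ` (`Q² < x`) is either central (`θ ≤ Q/x` or `1 − θ ≤ Q/x`) or has a reduced
  approximation `a'/q'`, `2 ≤ q' ≤ Q`, `1 ≤ a' < q'`, `(a', q') = 1`, `|θ − a'/q'| ≤ Q/x`.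

## References

* A. J. Harper, Compositio Math. 152 (2016), §5 [Harper2016].
-/

noncomputable section

open Finset Real

namespace Literature.NumberTheory.Sieve

namespace Endgame

open Vinogradov

/-! ### `∑ (1+j)^{-2}` -/

/-- `∑_{j<N} (1+j)^{−2} ≤ 2`. [folklore] -/
theorem sum_range_inv_one_add_sq_le_two (N : ℕ) :
    ∑ j ∈ Finset.range N, 1 / (1 + (j : ℝ)) ^ 2 ≤ 2 := by
  have h := sum_Ioo_inv_sq_le (α := ℝ) 0 (N + 1)
  have hre : ∑ j ∈ Finset.range N, 1 / (1 + (j : ℝ)) ^ 2 = ∑ i ∈ Finset.Ioo 0 (N + 1), ((i : ℝ) ^ 2)⁻¹ := by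
    refine Finset.sum_nbij' (fun j => j + 1) (fun i => i - 1) ?_ ?_ ?_ ?_ ?_
    · intro j hj; have := Finset.mem_range.mp hj; exact Finset.mem_Ioo.mpr ⟨by omega, by omega⟩
    · intro i hi; have := Finset.mem_Ioo.mp hi; exact Finset.mem_range.mpr (by omega)
    · intro j _; omega
    · intro i hi; have := Finset.mem_Ioo.mp hi; omega
    · intro j _; push_cast; rw [one_div]; ring
  rw [hre]
  refine h.trans ?_
  norm_num

/-- Comparison of sums along an injection, for non-negative targets. [folklore] -/
theorem sum_le_sum_of_injOn' {s t : Finset ℕ} (e : ℕ → ℕ) (he : Set.InjOn e s) (hst : ∀ r ∈ s, e r ∈ t)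
    (f g : ℕ → ℝ) (hg : ∀ j ∈ t, 0 ≤ g j) (h : ∀ r ∈ s, f r ≤ g (e r)) :
    ∑ r ∈ s, f r ≤ ∑ j ∈ t, g j := by
  classical
  calc ∑ r ∈ s, f r ≤ ∑ r ∈ s, g (e r) := Finset.sum_le_sum h
    _ = ∑ j ∈ s.image e, g j := (Finset.sum_image he).symm
    _ ≤ ∑ j ∈ t, g j :=
        Finset.sum_le_sum_of_subset_of_nonneg (Finset.image_subset_iff.mpr hst) fun j hj _ => hg j hj

/-- `∑_{r<N} (1+|r − c|)^{−2} ≤ 4` (`c ≥ 0`). [folklore] -/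
theorem sum_range_inv_one_add_abs_sub_sq_le {c : ℝ} (hc : 0 ≤ c) (N : ℕ) :
    ∑ r ∈ Finset.range N, 1 / (1 + |(r : ℝ) - c|) ^ 2 ≤ 4 := by
  classical
  set m : ℕ := ⌊c⌋₊ with hm
  have hmc : (m : ℝ) ≤ c := Nat.floor_le hc
  have hcm : c < m + 1 := Nat.lt_floor_add_one c
  set f : ℕ → ℝ := fun r => 1 / (1 + |(r : ℝ) - c|) ^ 2 with hf
  set g : ℕ → ℝ := fun j => 1 / (1 + (j : ℝ)) ^ 2 with hg
  have hg0 : ∀ j, 0 ≤ g j := fun j => by positivity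
  -- left part `r ≤ m`: `|r - c| ≥ m - r`
  have hleft : ∑ r ∈ (Finset.range N).filter (fun r => r ≤ m), f r ≤ ∑ j ∈ Finset.range (m + 1), g j := by
    refine sum_le_sum_of_injOn' (fun r => m - r) ?_ ?_ f g (fun j _ => hg0 j) ?_
    · intro r₁ hr₁ r₂ hr₂ heq
      have h1 := (Finset.mem_filter.mp hr₁).2
      have h2 := (Finset.mem_filter.mp hr₂).2
      simp only at heq
      omega
    · intro r hr; exact Finset.mem_range.mpr (by omega)
    · intro r hr
      have hrm : r ≤ m := (Finset.mem_filter.mp hr).2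
      simp only [hf, hg]
      have hcast : ((m - r : ℕ) : ℝ) = m - r := by rw [Nat.cast_sub hrm]
      rw [hcast]
      have habs : (m : ℝ) - r ≤ |(r : ℝ) - c| := by
        rw [abs_sub_comm]; exact le_trans (by linarith) (le_abs_self _)
      have hrm' : (r : ℝ) ≤ m := by exact_mod_cast hrm
      have h0 : 0 ≤ (m : ℝ) - r := by linarith
      apply one_div_le_one_div_of_le (by positivity)
      exact pow_le_pow_left₀ (by positivity) (by linarith) 2
  -- right part `r ≥ m + 1`: `|r - c| ≥ r - (m+1)`
  have hright : ∑ r ∈ (Finset.range N).filter (fun r => ¬ r ≤ m), f r ≤ ∑ j ∈ Finset.range N, g j := by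
    refine sum_le_sum_of_injOn' (fun r => r - (m + 1)) ?_ ?_ f g (fun j _ => hg0 j) ?_
    · intro r₁ hr₁ r₂ hr₂ heq
      have h1 := (Finset.mem_filter.mp hr₁).2
      have h2 := (Finset.mem_filter.mp hr₂).2
      simp only at heq
      omega
    · intro r hr
      have := Finset.mem_range.mp (Finset.mem_filter.mp hr).1
      exact Finset.mem_range.mpr (by omega)
    · intro r hr
      have hrm : m + 1 ≤ r := by have := (Finset.mem_filter.mp hr).2; omega
      simp only [hf, hg]
      have hcast : ((r - (m + 1) : ℕ) : ℝ) = r - (m + 1) := by rw [Nat.cast_sub hrm]; push_cast; ring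
      rw [hcast]
      have habs : (r : ℝ) - (m + 1) ≤ |(r : ℝ) - c| := le_trans (by linarith) (le_abs_self _)
      have hrm' : ((m + 1 : ℕ) : ℝ) ≤ r := by exact_mod_cast hrm
      push_cast at hrm'
      have h0 : 0 ≤ (r : ℝ) - (m + 1) := by linarith
      apply one_div_le_one_div_of_le (by positivity)
      exact pow_le_pow_left₀ (by positivity) (by linarith) 2
  rw [← Finset.sum_filter_add_sum_filter_not (Finset.range N) (fun r => r ≤ m) f]
  linarith [sum_range_inv_one_add_sq_le_two (m + 1), sum_range_inv_one_add_sq_le_two N]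

/-- **Along an arc.** For `x ≥ N₀ > 0` and `c' ≥ 0`:
`∑_{r<N₀} (1 + |(r/N₀ − c') x|)^{−2} ≤ 4`. [cite: Harper2016, §5] -/
theorem sum_range_inv_one_add_abs_arc_sq_le {N₀ : ℕ} (hN : 0 < N₀) {x : ℝ} (hx : (N₀ : ℝ) ≤ x)
    {c' : ℝ} (hc' : 0 ≤ c') :
    ∑ r ∈ Finset.range N₀, 1 / (1 + |((r : ℝ) / N₀ - c') * x|) ^ 2 ≤ 4 := by
  have hN0 : (0 : ℝ) < N₀ := by exact_mod_cast hN
  have hx0 : 0 < x := lt_of_lt_of_le hN0 hx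
  refine le_trans (Finset.sum_le_sum fun r _ => ?_) (sum_range_inv_one_add_abs_sub_sq_le (c := c' * N₀) (by positivity) N₀)
  have hid : ((r : ℝ) / N₀ - c') * x = ((r : ℝ) - c' * N₀) * (x / N₀) := by field_simp
  rw [hid, abs_mul, abs_of_pos (by positivity : 0 < x / N₀)]
  have h1 : 1 ≤ x / N₀ := by rw [le_div_iff₀ hN0]; linarith
  have h2 : |(r : ℝ) - c' * N₀| ≤ |(r : ℝ) - c' * N₀| * (x / N₀) := le_mul_of_one_le_right (abs_nonneg _) h1
  apply one_div_le_one_div_of_le (by positivity)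
  exact pow_le_pow_left₀ (by positivity) (by linarith) 2

/-! ### Distance to the nearest integer on `[0,1]` -/

/-- `min(θ, 1 − θ) ≤ ‖θ‖`. [folklore] -/
theorem min_le_distInt (θ : ℝ) : min θ (1 - θ) ≤ distInt θ := by
  unfold distInt
  set n : ℤ := round θ with hn
  rcases le_or_gt n 0 with hn0 | hn1
  · have : (n : ℝ) ≤ 0 := by exact_mod_cast hn0
    calc min θ (1 - θ) ≤ θ := min_le_left _ _
      _ ≤ |θ - n| := le_trans (by linarith) (le_abs_self _)
  · have : (1 : ℝ) ≤ n := by exact_mod_cast hn1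
    calc min θ (1 - θ) ≤ 1 - θ := min_le_right _ _
      _ ≤ |θ - n| := by rw [abs_sub_comm]; exact le_trans (by linarith) (le_abs_self _)

/-! ### Reduced rational approximations -/

/-- **Central or a reduced arc.** Let `1 ≤ Q`, `Q² < x`, `0 ≤ θ < 1`, and suppose
`|θ − a/q| ≤ Q/x` for some `1 ≤ q ≤ Q`, `a ∈ ℤ`. Then either `θ ≤ Q/x`, or `1 − θ ≤ Q/x`, or there are
`2 ≤ q' ≤ Q` and `1 ≤ a' < q'` coprime to `q'` with `|θ − a'/q'| ≤ Q/x`. [folklore] -/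
theorem exists_coprime_approx {Q x θ : ℝ} (hQ : 1 ≤ Q) (hQx : Q ^ 2 < x) (hθ0 : 0 ≤ θ) (hθ1 : θ < 1)
    {q : ℕ} (hq1 : 1 ≤ q) (hqQ : (q : ℝ) ≤ Q) {a : ℤ} (happ : |θ - a / q| ≤ Q / x) :
    θ ≤ Q / x ∨ 1 - θ ≤ Q / x ∨
      ∃ q' : ℕ, 2 ≤ q' ∧ (q' : ℝ) ≤ Q ∧ ∃ a' : ℕ, 1 ≤ a' ∧ a' < q' ∧ a'.Coprime q' ∧
        |θ - (a' : ℝ) / q'| ≤ Q / x := by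
  have hx0 : 0 < x := lt_of_le_of_lt (by positivity) hQx
  have hQ0 : 0 < Q := by linarith
  have hQx1 : Q / x < 1 / Q := by
    rw [div_lt_div_iff₀ hx0 hQ0]; nlinarith
  have hQx' : Q / x < 1 := lt_of_lt_of_le hQx1 (by rw [div_le_one hQ0]; exact hQ)
  -- reduce `a/q`
  have hg : 0 < Int.gcd a (q : ℤ) := Int.gcd_pos_of_ne_zero_right _ (by exact_mod_cast (by omega : q ≠ 0))
  obtain ⟨g, a', q'', hg0, hcop, ha, hq⟩ := Int.exists_gcd_one' hg
  have hq''pos : 0 < q'' := by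
    have : (0 : ℤ) < q'' * g := by rw [← hq]; exact_mod_cast hq1
    have hgpos : (0 : ℤ) < g := by exact_mod_cast hg0
    exact (mul_pos_iff_of_pos_right hgpos).mp this
  have hq''le : q'' ≤ q := by
    have : q'' * 1 ≤ q'' * (g : ℤ) := mul_le_mul_of_nonneg_left (by exact_mod_cast hg0) hq''pos.le
    rw [mul_one, ← hq] at this; exact this
  -- the same rational
  have hrat : (a : ℝ) / q = (a' : ℝ) / q'' := by
    have hg0' : (g : ℝ) ≠ 0 := by exact_mod_cast hg0.ne'
    have hq0' : (q'' : ℝ) ≠ 0 := by exact_mod_cast hq''pos.ne'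
    have ha' : (a : ℝ) = a' * g := by exact_mod_cast ha
    have hq' : ((q : ℤ) : ℝ) = q'' * g := by exact_mod_cast hq
    rw [show ((q : ℕ) : ℝ) = ((q : ℤ) : ℝ) by push_cast; rfl, ha', hq']
    field_simp
  rw [hrat] at happ
  -- `q''` as a natural number
  obtain ⟨q', hq'eq⟩ : ∃ q' : ℕ, (q' : ℤ) = q'' := ⟨q''.toNat, Int.toNat_of_nonneg hq''pos.le⟩
  have hq'pos : 0 < q' := by rw [← hq'eq] at hq''pos; exact_mod_cast hq''pos
  have hq'le : q' ≤ q := by rw [← hq'eq] at hq''le; exact_mod_cast hq''le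
  have hq'Q : (q' : ℝ) ≤ Q := le_trans (by exact_mod_cast hq'le) hqQ
  have happ' : |θ - (a' : ℝ) / q'| ≤ Q / x := by
    have : ((q'' : ℤ) : ℝ) = (q' : ℝ) := by rw [← hq'eq]; push_cast; rfl
    rwa [this] at happ
  have hcop' : Int.gcd a' (q' : ℤ) = 1 := by rw [hq'eq]; exact hcop
  rcases Nat.lt_or_ge q' 2 with hq'1 | hq'2
  · -- `q' = 1`: central
    have hq'one : q' = 1 := by omega
    rw [hq'one, Nat.cast_one, div_one] at happ'
    rcases le_or_gt a' 0 with ha0 | ha1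
    · rcases lt_or_eq_of_le ha0 with haneg | hazero
      · exfalso
        have : (a' : ℝ) ≤ -1 := by exact_mod_cast (show a' ≤ -1 by omega)
        have h := (abs_le.mp happ').2
        linarith
      · left
        rw [hazero, Int.cast_zero, sub_zero] at happ'
        exact le_trans (le_abs_self θ) happ'
    · rcases lt_or_eq_of_le (show (1 : ℤ) ≤ a' from ha1) with hbig | hone
      · exfalso
        have : (2 : ℝ) ≤ a' := by exact_mod_cast (show 2 ≤ a' by omega)
        have h := (abs_le.mp happ').1
        linarith
      · right; left
        rw [← hone, Int.cast_one] at happ'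
        have h := (abs_le.mp happ').1
        linarith
  · -- `q' ≥ 2`: a reduced arc
    right; right
    have hq'0 : (0 : ℝ) < q' := by exact_mod_cast hq'pos
    have hq'inv : 1 / Q ≤ 1 / (q' : ℝ) := one_div_le_one_div_of_le hq'0 hq'Q
    -- `1 ≤ a' ≤ q' - 1`
    have ha_pos : 1 ≤ a' := by
      by_contra hle
      push Not at hle
      rcases lt_or_eq_of_le (show a' ≤ 0 by omega) with hneg | hzero
      · -- `a' ≤ -1`: `θ - a'/q' ≥ 1/q' ≥ 1/Q > Q/x`
        have : (a' : ℝ) ≤ -1 := by exact_mod_cast (show a' ≤ -1 by omega)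
        have h1 : (a' : ℝ) / q' ≤ -(1 / q') := by
          rw [div_le_iff₀ hq'0, neg_mul, one_div_mul_cancel hq'0.ne']; linarith
        have h := (abs_le.mp happ').2
        linarith
      · -- `a' = 0`: not coprime to `q' ≥ 2`
        rw [hzero, Int.gcd_zero_left, Int.natAbs_natCast] at hcop'
        omega
    have ha_lt : a' < q' := by
      by_contra hle
      push Not at hle
      rcases lt_or_eq_of_le hle with hbig | heq
      · -- `a' ≥ q' + 1`: `a'/q' − θ ≥ 1/q' > Q/x`
        have : ((q' : ℤ) : ℝ) + 1 ≤ a' := by exact_mod_cast (show (q' : ℤ) + 1 ≤ a' by omega)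
        push_cast at this
        have h1 : 1 + 1 / (q' : ℝ) ≤ (a' : ℝ) / q' := by
          rw [le_div_iff₀ hq'0, add_mul, one_div_mul_cancel hq'0.ne']; linarith
        have h := (abs_le.mp happ').1
        linarith
      · -- `a' = q'`: not coprime
        rw [← heq, Int.gcd_self, Int.natAbs_natCast] at hcop'
        omega
    obtain ⟨a₀, ha₀⟩ : ∃ a₀ : ℕ, (a₀ : ℤ) = a' := ⟨a'.toNat, Int.toNat_of_nonneg (by omega)⟩
    refine ⟨q', hq'2, hq'Q, a₀, by omega, by omega, ?_, ?_⟩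
    · have : Int.gcd (a₀ : ℤ) (q' : ℤ) = 1 := by rw [ha₀]; exact hcop'
      rwa [Int.gcd_natCast_natCast] at this
    · have : ((a' : ℤ) : ℝ) = (a₀ : ℝ) := by rw [← ha₀]; push_cast; rfl
      rwa [this] at happ'

end Endgame

end Literature.NumberTheory.Sieve

end
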